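/- Free-seat work of EXTRA WIDTH SEAT `ym-line-cbag-p1-w5` (prover-ym-line-cbag-p1-w5-g2-0), route `EguchiKawaiDirectionLadder`
(ideator ym-idea-2, LINE 8), crux `TripleSmallBallMargin` (stmt-QuantumFields-27724): a DOOR for the within-cluster stub
(a′) `FreeTripleSmallBall` (repaired: `t ≤ 1`) — the CONDITIONAL TRIPLE BOUND, a small-ball statement about TWO independent Haar
unitaries facing a FIXED DIAGONAL first link, with the explicit per-pair factor that Weyl's integration formula cancels against
the Vandermonde weight (`x · triplePairFactor t x ≤ t^{3/2}`).  Definitions only (route-posited objects); the reduction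
(a′) ⇐ Weyl + `ConditionalTripleBound` is kernel-checked in `EguchiKawaiDirectionLadderFreeTripleOfConditional.lean`; nothing is
claimed about `ConditionalTripleBound` itself (it carries the XL content).  ROUTE-INDEPENDENT.  Nothing here bears on the
Yang–Mills mass gap (barrier-ledger line onto `EguchiKawaiBreakdown`). -/
import Literature.Barriers.QuantumFields.EguchiKawaiBreakdown
import Literature.LinearAlgebra.Matrix.UnitaryGroupMaximalTorus
import HarnessLib

/-!
# Route `EguchiKawaiDirectionLadder`, crux `TripleSmallBallMargin`: the conditional triple bound (objects)

The Bhanot–Heller–Neuberger power count for Haar triples `(U₀, U₁, U₂) ∈ U(N)³` with small reduced action `S_R ≤ t`, read PER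
UNORDERED PAIR `{j, k}` of eigenvalues `z_j = e^{iθ_j}` of `U₀` (write `x = |z_j − z_k|²`):

* the Vandermonde weight of `U₀` (Weyl's integration formula): `x`;
* off-pair RIGIDITY of `U₁` AND of `U₂` in the eigenbasis of `U₀` (`‖[U₀, W]‖_F² = Σ_{jk} x_jk |W_jk|² ≤ 2Nt`): a factor `t/x` each
  once `x ≥ t`, i.e. `(t / max(x,t))²`;
* the `[U₁, U₂]` constraint INSIDE a `t^{1/4}`-cluster of `U₀` (where rigidity leaves the pair `(U₁, U₂)` room of relative size
  `t/x`): the budgeted pair cost `min(1, max(x,t)²/t)` — `t` for `x ≤ t` (the plain pair bound), `x²/t` for `t ≤ x ≤ √t`, free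
  beyond `x ≥ √t`.

Their product `triplePairFactor t x` satisfies `x · triplePairFactor t x ≤ t^{3/2}` for all `x ≥ 0`, `0 < t ≤ 1`, with equality along
the whole BHN-flat range `t ≤ x ≤ √t` — the exponent `3/4 = (3/2)·(1/2)` per ordered pair.  `ConditionalTripleBound` asserts the
corresponding fibre bound for the Eguchi–Kawai a-priori measure CONDITIONED on the first link being `diag(e^{iθ})` (uniformly in
`θ` and `N ≥ N₀`, for `0 < t ≤ 1`, with an `e^{N²(C − η log t)}` slack).  Consistency checks (uniform eigenvalue clouds of `U₀` at
every scale `ρ` — maximal contribution exactly at `ρ = t^{1/4}` —, two antipodal clusters, and their mixtures) are recorded in the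
evidence note `evidence-stub-a-misstated.md` on stmt-QuantumFields-27724.
-/

set_option autoImplicit false

noncomputable section

open MeasureTheory
open Literature.Barriers.QuantumFields
open Literature.LinearAlgebra.Matrix (diagonalTorusHom)

namespace Summit.QuantumFields.YangMills.Theorems.EguchiKawaiDirectionLadder

/-- The PER-PAIR FACTOR of the conditional triple bound at budget `t` and squared eigenvalue distance `x = |z_j − z_k|²` of the
first link: `(t / max(x,t))² · min(1, max(x,t)²/t)` — rigidity of the two other links off the pair times the budgeted
`[U₁,U₂]` pair cost inside `t^{1/4}`-clusters.  Object posited by the (a′)-door of stmt-QuantumFields-27724. -/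
def triplePairFactor (t x : ℝ) : ℝ :=
  (t / max x t) ^ 2 * min 1 (max x t ^ 2 / t)

/-- **The conditional triple bound** (door for the repaired within-cluster stub (a′) of stmt-QuantumFields-27724; carries the XL
content; NOT proved anywhere): for every `η > 0` there are `C ≥ 0` and `N₀` such that for all `N ≥ N₀`, `0 < t ≤ 1` and all
eigenangles `θ`, the `Haar ⊗ Haar` probability that the configuration `(diag(e^{iθ}), W₁, W₂)` has reduced action `≤ t` is at most
`exp(N²(C − η log t)) · ∏_{j<k} triplePairFactor t |e^{iθ_j} − e^{iθ_k}|²`. -/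
def ConditionalTripleBound : Prop :=
  ∀ η : ℝ, 0 < η → ∃ C : ℝ, 0 ≤ C ∧ ∃ N₀ : ℕ, ∀ N : ℕ, N₀ ≤ N → ∀ t : ℝ, 0 < t → t ≤ 1 →
    ∀ θ : Fin N → ℝ,
      ekHaar 2 N {W : EKConfig 2 N |
          ekAction (Fin.cons (diagonalTorusHom (Fin N) fun j => Circle.exp (θ j)) W : EKConfig 3 N) ≤ t} ≤
        ENNReal.ofReal (Real.exp ((N : ℝ) ^ 2 * (C - η * Real.log t)) *
          ∏ j : Fin N, ∏ k ∈ Finset.Ioi j,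
            triplePairFactor t (‖Complex.exp (θ j * Complex.I) - Complex.exp (θ k * Complex.I)‖ ^ 2))

end Summit.QuantumFields.YangMills.Theorems.EguchiKawaiDirectionLadder

end
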